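import Literature.MathematicalPhysics.QuantumFieldTheory.Balaban1983to89.B8Thm2T3FamilyBinderSharp
import Literature.MathematicalPhysics.QuantumFieldTheory.Balaban1983to89.B8Eq159TorusPerOfSockB9P3Per

/-!
# `Balaban1983to89.B8Thm2T3FamilyBinderSockPer` — sub-row G-B8-T2S file A17: the `hThm2` binder of the 19200 dictionary with the (B)-arrow
# displayed as pub-ymgap's GUARDED SHARED SOCKET `SockB9P3Per` at radius `c_P`, the knit's radius served as `c_L ≤ c_P`

statement-level skeleton of published theorems with citation tags; proofs where landed; nothing here is a claim about the
Yang–Mills mass gap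

Sub-row G-B8-T2S «[B8] §3 Thm 2 TORUS SUPPLIER» (unit `lit-balaban-t2s-1`, gen 6), lit-balaban RULING #9 (2) ∕ ADDENDUM (2)(b) (lead g32,
2026-08-28): «A17: re-thread `hb9` so the endpoint displays ONE socket shape shared with pub-ymgap — `∀ m ≤ k, SockB9P3Per …(torusIdx …)` — radius
served as `α₀ ≤ min(c_L, c_P)` with `c_B9 := c_P`».  The socket `B8LeafModelZd3SockPer.SockB9P3Per` (pub-ymgap dag-n06-b, p641252) is [B8] (1.59)'s
conclusion behind the guards «U₀, W, A′ are P-periodic» (the torus `T_η` read on `ℤ^{d+1}`, p. 77 «we admit the case when some domains Ω_j are equal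
to T_η»); r05's guarded twin `B8Eq159TorusPerOfSockB9P3Per.b9Arrow_of_sockB9P3Per` (p641798) turns it into EXACTLY the `hb9` binder of files
A14 ∕ A15 (`hThm2_of_core` ∕ `hThm2_of_core_sharp`) at every radius `c_L ≤ c_P`, `c_B9 ≤ c_P`.  THIS FILE serves the radius: file A12's constants
theorem (`B8Thm2TorusKnitParamsExist.exists_valid`) constrains `c_L` only from ABOVE (`c_L·L² < α₀′(p)`, `0 < c_L`), so `min c_L c_P` is an admissible
radius — we re-run A12's catalogue endpoint `B8Thm2TorusMemberCatalogue.thm2SetupSUAt_catalogued_exists` at `min c_L c_P`, repackage the cube data as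
in A14 (`KnitCubeAnalytic.ofCore`) and the family as in A15 (`P_eq_PV`, floor `k₀ ≤ F.m + n` after `n < K`), and discharge `hb9` by r05's arrow.

Sources: `[Balaban1985RegularSpaces]` Thm 2 p. 83, (1.57)–(1.59) p. 86, Prop. 3 p. 87, p. 77; `[Balaban1985BackgroundPropagators]` Thm 3.3 p. 399 (named
only), Thm 3.7 p. 410, Thm 3.9 p. 413; `[Balaban1984PropagatorsII]` (2.1)–(2.4) p. 224.

WHAT IS PROVED (kernel, 0 sorry, one theorem): ★★★ `hThm2_of_core_sockPer` — A15's `hThm2_of_core_sharp` VERBATIM except (i) a radius `c_P` with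
`c_B9 ≤ c_P` is an input and `c_L ≤ c_P` is an output clause, (ii) the (B)-arrow hypothesis is `∀ m′ ≤ K − n, SockB9P3Per P₀ L B₀ B₀β c_P β_H len η m′
{T_η} torusLam torusLamb` (P₀ the family's period, η = `eta F n K`) instead of the knit's `B9P3PerAt` binder.  Antecedents displayed, inhabited by
nothing here; no estimate of [B8] ∕ [4] proved; `SockB9P3Per` is NOT inhabited here (pub-ymgap N06's, Thm 3.3 at the torus through the Neumann
junction — files `B9B8Knit*` of this seat); `stub_PV3A` ∕ `B9P3PerAt` NOT discharged; count-neutral; nothing continuum ∕ ℝ⁴ ∕ OS ∕ mass gap ∕ Clay —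
the Yang–Mills mass gap is NOT proved by any of this (Track A conditional rung).  No `def`, no `… : Prop` fact, no `instance`, no `notation`.  NEW file;
A12 ∕ A14 ∕ A15 and r05's twin used BY NAME, nothing landed is modified.
-/

noncomputable section

open scoped BigOperators

namespace Literature.MathematicalPhysics.QuantumFieldTheory.Balaban1983to89.B8Thm2T3FamilyBinderSockPer

open Node00 B6KLevelCensusIndexV1 B9BackgroundsKLevelV1 B9Thm311ReadingCoords
open B7Prop1Explicit renaming Site → LSite
open B7Prop1Explicit (e)
open B9GeoNormsKLevelV1 (geo9K)
open B6GlobalChartV1 (PV)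
open B6Ineq2142KLevelV1 (β)
open B8Ineq132 (InAk)
open B8Thm2TorusLettersPerOfKnit (bgY)
open B8Thm2TorusKnitMajorantsOfCubes (KnitCubeParams)
open B8Thm2TorusKnitCubeGeometry (KnitCubeAnalytic)
open B8Thm2TorusKnitCubeCore (KnitCubeCore)
open B8Thm2TorusKnitParamsExist (exists_valid)
open B8Thm2TorusMemberCatalogue (thm2SetupSUAt_catalogued_exists)
open B8Thm2T3FamilyBinder (P_eq_PV)
open B7Prop2SpecialUnitary (specialUnitaryUnits)
open B8Thm2SetupTorus (Thm2SetupSUAt)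
open B8Thm4TorusAt (torusLam)
open B8Thm2TorusMember (torusLamb)
open B8LeafModelZd3SockPer (SockB9P3Per)
open B8Eq159TorusPerOfSockB9P3Per (b9Arrow_of_sockB9P3Per)
open T3ContinuumYM3Torus (T3Family)
open T3SectALandauChart (eta eta_pos)
open scoped Matrix Matrix.Norms.L2Operator

variable {ℓ : ℕ} {hL : Odd (ℓ + 1) ∧ 1 < ℓ + 1} {b₀ b₁ : ℝ}

section BinderSockPer

variable {hd₃ : 1 ≤ 2 + 1}
variable [instF : ∀ i : KIdx 2 ℓ hd₃ hL b₀ b₁, Fintype (geo9K i).Site] [∀ i : KIdx 2 ℓ hd₃ hL b₀ b₁, DecidableEq (geo9K i).Site]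

/-- ★★★ **THE `hThm2` BINDER WITH THE GUARDED SHARED SOCKET AS THE (B)-ARROW** (lit-balaban RULING #9 (2) ∕ ADDENDUM (2)(b)): file A15's
`hThm2_of_core_sharp` with a radius `c_P ≥ c_B9` as input, the knit's radius served as `c_L ≤ c_P`, and the (B)-arrow hypothesis displayed as
`∀ m′ ≤ K − n, SockB9P3Per P₀ L B₀ B₀β c_P β_H len η m′ {T_η} torusLam torusLamb` — pub-ymgap's guarded socket ([B8] (1.59) on the torus, `U₀, W, A′`
periodic), turned into the knit's `B9P3PerAt` binder by r05's `b9Arrow_of_sockB9P3Per`.  ∀ `F : T3Family` with `F.L = ℓ + 1`, ∀ `n < K` with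
`k₀ ≤ F.m + n`: core cube data at the members `mem P₀ j` (`j ≤ K − n`, `SU(2)`-valued `P₀`-periodic `U₀ ∈ 𝔄_j(T_η, α₀)`, `α₀ ≤ c_L`) → the socket at
all truncations `m′ ≤ K − n` → `∃ β₀ B₂′ len′, Thm2SetupSUAt (F.P K) 2 (K − n) (eta F n K) β₀ B₁ B₂′ c₁ len′ (fun _ => True)`.  Antecedents displayed,
inhabited by nothing here; the Yang–Mills mass gap is NOT proved.
[cite: Balaban1985RegularSpaces, Thm 2 p.83, (1.59) p.86, Prop. 3 p.87, p.77 («Ω_j = T_η»); Balaban1985BackgroundPropagators, Thm 3.7 p.410, Thm 3.9 p.413; Balaban1984PropagatorsII, (2.1)–(2.4) p.224] -/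
theorem hThm2_of_core_sockPer (hℓ : 4 ≤ ℓ) (hb₀ : 0 < b₀) (hb₁ : b₀ ≤ b₁)
    {B₀ B₀β cB9 βH cP : ℝ} {len : LSite (2 + 1) → ℝ}
    (hB₀ : 0 < B₀) (hB : 2 ≤ 5 * ((2 + 1 : ℕ) : ℝ) * ((ℓ + 1 : ℕ) : ℝ) * B₀) (hcB9 : 0 < cB9) (hcP : cB9 ≤ cP)
    {ι : Type} [Fintype ι] [DecidableEq ι] (b : Module.Basis ι ℝ (Matrix (Fin 2) (Fin 2) ℂ)) {M₂ : ℝ} (hM₂ : 0 ≤ M₂)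
    (hrepr : ∀ (v : Matrix (Fin 2) (Fin 2) ℂ) (j : ι), |b.repr v j| ≤ M₂ * ‖v‖)
    {BG₀ δG₀ NG NG' AE Ac δc BC δC Nn κD : ℝ} (hBG₀ : 0 ≤ BG₀) (hδG₀ : 0 < δG₀) (hNG : 0 ≤ NG) (hNG' : 0 ≤ NG')
    (hAE : 0 ≤ AE) (hAc : 0 ≤ Ac) (hδc : 0 < δc) (hBC : 0 ≤ BC) (hδC : 0 < δC) (hNn : 0 ≤ Nn) (hκD : 0 ≤ κD) (Rr : ℝ) (Hp : Prop) :
    letI : CStarAlgebra (Matrix (Fin 2) (Fin 2) ℂ) := {}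
    ∃ θs ℓs Ds cL A δG δ₀ : ℝ, 0 < θs ∧ 0 < ℓs ∧ 0 < cL ∧ cL ≤ cP ∧ Ac ≤ A ∧ 0 < δG ∧ δG ≤ δc ∧ 0 < δ₀ ∧ δ₀ ≤ δC ∧
      ∀ θG ℓ₀ ℓ₁ Dsep : ℝ, 0 ≤ θG → θG ≤ θs → 0 ≤ ℓ₀ → ℓ₀ ≤ ℓs → 0 ≤ ℓ₁ → ℓ₁ ≤ ℓs → Ds ≤ Dsep →
        ∃ p : KnitCubeParams,
          (p.BG₀ = BG₀ ∧ p.δG₀ = δG₀ ∧ p.NG = NG ∧ p.NG' = NG' ∧ p.AE = AE ∧ p.θG = θG ∧ p.A = A ∧ p.δG = δG ∧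
            p.B₀ = BC ∧ p.δ₀ = δ₀ ∧ p.bb = 1 ∧ p.aD = 1 ∧ p.Nn = Nn ∧ p.κD = κD ∧ p.Dsep = Dsep ∧ p.ℓ₀ = ℓ₀ ∧ p.ℓ₁ = ℓ₁) ∧
        ∃ (k₀ : ℕ) (mem : ℤ → ℕ → KIdx 2 ℓ hd₃ hL b₀ b₁) (ιBm : ∀ P n, BlkY (mem P n) → IBondY (mem P n)) (B₁ B₂ c₁ : ℝ),
          0 < B₁ ∧ 0 < B₂ ∧ 0 < c₁ ∧
          (∀ (m K n : ℕ), 1 ≤ n → n + k₀ ≤ m + K →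
            (mem (((PV 2 ℓ m K hd₃ hL).sitesPerDir 0 : ℕ) : ℤ) n).m = m + K ∧ (mem (((PV 2 ℓ m K hd₃ hL).sitesPerDir 0 : ℕ) : ℤ) n).K = 0 ∧
            (mem (((PV 2 ℓ m K hd₃ hL).sitesPerDir 0 : ℕ) : ℤ) n).k = n + 1 ∧
            (mem (((PV 2 ℓ m K hd₃ hL).sitesPerDir 0 : ℕ) : ℤ) n).cf = (((ℓ + 1 : ℕ) : ℝ)) ^ (mem (((PV 2 ℓ m K hd₃ hL).sitesPerDir 0 : ℕ) : ℤ) n).k ∧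
            (∀ z : SiteY (mem (((PV 2 ℓ m K hd₃ hL).sitesPerDir 0 : ℕ) : ℤ) n), levY (mem (((PV 2 ℓ m K hd₃ hL).sitesPerDir 0 : ℕ) : ℤ) n) z = n) ∧
            ∀ t, β (mem (((PV 2 ℓ m K hd₃ hL).sitesPerDir 0 : ℕ) : ℤ) n).hN (mem (((PV 2 ℓ m K hd₃ hL).sitesPerDir 0 : ℕ) : ℤ) n).D
              (mem (((PV 2 ℓ m K hd₃ hL).sitesPerDir 0 : ℕ) : ℤ) n).hk (ιBm (((PV 2 ℓ m K hd₃ hL).sitesPerDir 0 : ℕ) : ℤ) n t) = t) ∧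
          ∀ F : T3Family, F.L = ℓ + 1 → ∀ (n K : ℕ), n < K → k₀ ≤ F.m + n →
            (∀ j, 1 ≤ j → j ≤ K - n → ∀ ⦃α₀ : ℝ⦄, 0 < α₀ → α₀ ≤ cL → ∀ U₀ : LSite (2 + 1) → Fin (2 + 1) → (Matrix (Fin 2) (Fin 2) ℂ)ˣ,
                (∀ x κ, U₀ x κ ∈ specialUnitaryUnits (Fin 2)) →
                (∀ (x : LSite (2 + 1)) (μ : Fin (2 + 1)), U₀ (x + (((PV 2 ℓ F.m K hd₃ hL).sitesPerDir 0 : ℕ) : ℤ) • e μ) = U₀ x) →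
                InAk (ℓ + 1) j (eta F n K) α₀ (fun _ => (Set.univ : Set (LSite (2 + 1)))) U₀ →
                Nonempty (KnitCubeCore (mem (((PV 2 ℓ F.m K hd₃ hL).sitesPerDir 0 : ℕ) : ℤ) j)
                  (bgY (mem (((PV 2 ℓ F.m K hd₃ hL).sitesPerDir 0 : ℕ) : ℤ) j) U₀) b (ιBm (((PV 2 ℓ F.m K hd₃ hL).sitesPerDir 0 : ℕ) : ℤ) j) Rr Hp p)) →
            (∀ m', m' ≤ K - n →
                SockB9P3Per (𝔸 := Matrix (Fin 2) (Fin 2) ℂ) ((PV 2 ℓ F.m K hd₃ hL).sitesPerDir 0) (ℓ + 1) B₀ B₀β cP βH len (eta F n K) m'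
                  (fun _ => (Set.univ : Set (LSite (2 + 1)))) (fun m'' => torusLam (d := 2 + 1) m'') (fun m'' => torusLamb (d := 2 + 1) m'')) →
            ∃ (β₀ B₂' : ℝ) (len' : LSite (F.P K).d → ℝ),
              Thm2SetupSUAt (F.P K) 2 (K - n) (eta F n K) β₀ B₁ B₂' c₁ len' (fun _ => True) := by
  letI : CStarAlgebra (Matrix (Fin 2) (Fin 2) ℂ) := {}
  have hcP0 : 0 < cP := hcB9.trans_le hcP
  obtain ⟨θs, ℓs, Ds, cL, A, δG, δ₀, hθs, hℓs, hcL, hA, hδG, hδGc, hδ₀, hδ₀C, H⟩ :=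
    exists_valid (d := 2) (ℓ := ℓ) (hd := hd₃) (hL := hL) (b₀ := b₀) (b₁ := b₁) b hM₂ hrepr hBG₀ hδG₀ hNG hNG' hAE hAc hδc hBC hδC hNn hκD
  refine ⟨θs, ℓs, Ds, min cL cP, A, δG, δ₀, hθs, hℓs, lt_min hcL hcP0, min_le_right _ _, hA, hδG, hδGc, hδ₀, hδ₀C,
    fun θG ℓ₀ ℓ₁ Dsep h1 h2 h3 h4 h5 h6 h7 => ?_⟩
  obtain ⟨p, dρ, hV, hGv, hwin, hspec⟩ := H θG ℓ₀ ℓ₁ Dsep h1 h2 h3 h4 h5 h6 h7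
  have hwin' : min cL cP * (((ℓ + 1 : ℕ) : ℝ)) ^ (2 * 1) < p.α₀' :=
    lt_of_le_of_lt (mul_le_mul_of_nonneg_right (min_le_left _ _) (by positivity)) hwin
  obtain ⟨k₀, mem, ιBm, B₁, B₂, c₁, hB₁, hB₂, hc₁, hcat, hend⟩ :=
    thm2SetupSUAt_catalogued_exists (d := 2) (hd := hd₃) (hL := hL) (len := len) (B₀β := B₀β) (βH := βH) (by norm_num) (by norm_num) hℓ hb₀ hb₁
      hB₀ hB hcB9 (lt_min hcL hcP0) p hV hGv hwin' Rr Hp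
  refine ⟨p, hspec, k₀, mem, ιBm, B₁, B₂, c₁, hB₁, hB₂, hc₁, hcat, fun F hF n K hnK hm hanC hS => ?_⟩
  -- the (B)-arrow at radius `min c_L c_P ≤ c_P` from the guarded socket (r05's twin)
  have hb9 := b9Arrow_of_sockB9P3Per (d := 2) (N := 2) (cB := cB9) (cL := min cL cP) hS hcP (min_le_right _ _)
  have hT : Thm2SetupSUAt (PV 2 ℓ F.m K hd₃ hL) 2 (K - n) (eta F n K) 0 B₁ B₂ c₁ len (fun _ => True) := by
    refine hend F.m K (K - n) (eta F n K) (by omega) (by omega) (eta_pos F n K) (fun j hj hjk α₀ hα hαc U₀ hG hper hAk => ?_) hb9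
    obtain ⟨-, -, -, hcf, -, hι⟩ := hcat F.m K j hj (by omega)
    obtain ⟨core⟩ := hanC j hj hjk hα hαc U₀ hG hper hAk
    exact ⟨KnitCubeAnalytic.ofCore hι hcf core⟩
  rw [P_eq_PV (hd := hd₃) (hL := hL) F hF K]
  exact ⟨0, B₂, len, hT⟩

end BinderSockPer

end Literature.MathematicalPhysics.QuantumFieldTheory.Balaban1983to89.B8Thm2T3FamilyBinderSockPer

end
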